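import Summits.ValiantsHypothesis.ValiantsHypothesis.Theorems.NcBinarisationParseTrees
import Summits.ValiantsHypothesis.ValiantsHypothesis.Theorems.NcParseTreePermanent
import HarnessLib

/-!
# UPT normal form and the PERM / LID rungs for product gates of ANY fan-in (via LLS18 Lemma 8)

LLS18 = Lagarde–Limaye–Srinivasan 2018. THIS FILE (no definitions) removes the one model
restriction — product fan-in ≤ 2 — of the landed print-UPT / print-rotUPT rungs
(`NcParseTreePermanent`): by the parse-tree identity `circuitPts (binz P) = combCircuitPts P`
(`NcBinarisationParseTrees`), a circuit `P` with product gates of ANY fan-in whose comb parse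
trees all have shape `T` (in particular a PRINT-UPT circuit, LLS18 §3) binarises to a circuit
`binz P` with product fan-in ≤ 2, the same value, all parse trees of shape `T`, and
`(binz P).size = Σ max(1, fanIn−1) ≤ P.size + P.edgeSize` (gates + wires); so every landed theorem about print-UPT
circuits with binary products applies to `binz P` BY NAME: (§1) non-vacuity and the comb-vs-rot
witness; (§2) ★ `exists_uptNF_of_combUPT` (LLS18 Prop 7(2) + Lemma 8: a typed UPT normal form of
size `3(2|T|−1)((binz P).size+1)`), `exists_rotNF_of_combRot`; (§3) the transfers
`ncPerPoly_combUPT` (`2^{r+1} ≤ 24r((binz P).size+1)`), `ncPerPoly_combRot`, `lidPoly_combRot`;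
(§4) the eventually-forms along `n = 4r`: `perNotNcCombUPT_eventually` — for every `c`,
eventually every comb-UPT (a fortiori print-UPT, any product fan-in) circuit for `PERM_{4r}`
without `const` operands / empty products has `(4r)^c + c < P.size + P.edgeSize` (gates + wires) —
and `perNotNcCombRot_eventually`.
MODEL (the sentence of bus OFFER 2482 / CALL 2483, VERBATIM): «Circuits ArithCircuit R σ read in
FreeAlgebra R σ (ncEval): weighted sum gates of any fan-in, ORDERED product gates of ANY fan-in; NO
`const` operands (print: inputs are variables, constants live on the + wires, LLS18 p. 7) and, for
the value theorems, NO EMPTY products (prod [] computes 1, which has no parse tree). A parse tree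
keeps one summand of every sum gate and ALL factors of every product gate; a k-ary product node is
RECORDED as its left comb ((t₁t₂)t₃)⋯t_k in the binary Shape (fan-in 1 transparent, fan-in 2 = the
landed circuitPts, LITERAL agreement combCircuitPts P = circuitPts P when all product fan-ins ≤ 2).
PRINT-UPT of shape T (LLS18 §3, any fan-in) ⇒ comb-UPT (all comb parse trees have one shape, the
comb of T); NOT conversely (the encoding forgets arities) — so every bound stated against comb-UPT
circuits IS a bound against print-UPT circuits of arbitrary product fan-in, size measured by gates +
wires (print measures wires). Comb-rotUPT is a KERNEL class: = print-rotUPT (LLS18 §4) at fan-in ≤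
2, INCOMPARABLE with it at fan-in ≥ 3 (reordering three children is not a rotation of the comb:
comb_rot_witness) — the Rot statements are NOT print-rotUPT for fan-in ≥ 3. binz = LLS18 Lemma 8's
chain of k−1 binary products with references renumbered by prefix sums; (binz P).size = Σ max(1,
fanIn−1) ≤ P.size + P.edgeSize. The constants are those of the landed transfers (WEAKER than the
typed rungs). NOT a new lower bound; 0 S-currency; closes NO item; A_nc stmt-23446 / PerNotNcVP / VP
≠ VNP untouched.»
NON-VACUOUS (K6): `binz_P1` — the ternary product `xyz` (product fan-in 3: outside every landed
binary rung) binarises to `x·y, g₀·z` and its one comb parse tree is `((xy)z)`; `comb_rot_witness` —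
the combs of a ternary node with children (N,L,L) resp. (L,L,N) are NOT `rotSim`; for EVERY `r ≥ 1`
the sum gate over the `(4r)!` permutations of ONE `4r`-ary product gate `x_{1π(1)} ⋯ x_{4r,π(4r)}`
per permutation computes `PERM_{4r}` with product fan-in `4r`, no `const` operand (coefficients ride
on the sum) and no empty product, and is print-UPT (every parse tree is the `4r`-star), hence
comb-UPT — so the `∀ r ≥ r₀` binders of §4 carry content at every `r` and NO landed binary-product
rung speaks about these circuits. DEGENERATE READINGS: `T = leaf` ⇒ circuits all of whose parse
trees are leaves (harmless); a 0-gate `P` and a dangling output `gate j` (renumbered to the total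
size, still out of range) give `[]` / `0` on both sides of the identity; an all-binary `P` has
`combCircuitPts P = circuitPts P` literally; no `∃` over a size parameter anywhere.
[cite: LagardeLimayeSrinivasan2018, §2, §3 Proposition 7, Lemma 8, Theorem 10, §4 Theorem 17]
[cite: LimayeMalodSrinivasan2016, §7] [cite: HrubesWigdersonYehudayoff2010, Lemma C.5]
-/

noncomputable section

namespace Summit.ValiantsHypothesis.ValiantsHypothesis.Theorems.NcBinarisationPermanent

set_option linter.dupNamespace false
open Literature.Computability.AlgebraicComplexity
  Literature.Computability.AlgebraicComplexity.ArithCircuit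
  Summit.ValiantsHypothesis.ValiantsHypothesis.Theorems.NcBlockForms
  Summit.ValiantsHypothesis.ValiantsHypothesis.Theorems.NcCayleyDeterminant
  Summit.ValiantsHypothesis.ValiantsHypothesis.Theorems.NcSOSPermanent
  Summit.ValiantsHypothesis.ValiantsHypothesis.Theorems.NcUniqueParseTree
  Summit.ValiantsHypothesis.ValiantsHypothesis.Theorems.NcRotParseTree
  Summit.ValiantsHypothesis.ValiantsHypothesis.Theorems.NcParseTrees
  Summit.ValiantsHypothesis.ValiantsHypothesis.Theorems.NcParseTreeValues
  Summit.ValiantsHypothesis.ValiantsHypothesis.Theorems.NcParseTreePermanent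
  Summit.ValiantsHypothesis.ValiantsHypothesis.Theorems.NcBinarisation
  Summit.ValiantsHypothesis.ValiantsHypothesis.Theorems.NcBinarisationParseTrees

universe u v w

section Headlines
variable {R : Type u} [CommSemiring R] {σ : Type v}

/-! ### §1 Non-vacuity and the comb-vs-rotation witness -/

/-- K6: the TERNARY product `xyz` (fan-in 3, outside the landed binary model) binarises to
`x·y, g₀·z` (output `g₁`), and its unique comb parse tree is `((xy)z)` with term `xyz`.
[cite: LagardeLimayeSrinivasan2018, §3 Lemma 8] -/
theorem binz_P1 (x y z : σ) :
    binz (⟨[Gate.prod [.var x, .var y, .var z]], .gate 0⟩ : ArithCircuit R σ) =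
      ⟨[Gate.prod [.var x, .var y], .prod [.gate 0, .var z]], .gate 1⟩ ∧
    combCircuitPts (⟨[Gate.prod [.var x, .var y, .var z]], .gate 0⟩ : ArithCircuit R σ) =
      [(Shape.node (.node .leaf .leaf) .leaf,
        FreeAlgebra.ι R x * FreeAlgebra.ι R y * FreeAlgebra.ι R z)] := by
  constructor
  · simp [binz, binBlocks, block, chainGates, bop, btbl, boff, width]
  · simp [combCircuitPts, combPtLists, combGatePts, chainPts, pairPts, opPts]

/-- K6: combing does NOT respect reordering of three children — the combs of `(t₁t₂)t₃` with
child shapes `(N, L, L)` and `(L, L, N)` (`N = node leaf leaf`, `L = leaf`) are not rotations of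
each other; so comb-rotUPT ≠ print-rotUPT at fan-in ≥ 3. [cite: LagardeLimayeSrinivasan2018, §4] -/
theorem comb_rot_witness :
    rotSim true (Shape.node (.node (.node .leaf .leaf) .leaf) .leaf)
      (.node (.node .leaf .leaf) (.node .leaf .leaf)) = false := by
  simp [rotSim]

/-! ### §2 UPT / rot normal forms for product gates of any fan-in -/

/-- ★ **comb-UPT ⊆ UPT-NF IN KERNEL, ANY PRODUCT FAN-IN** (LLS18 Lemma 8 + Prop 7(2)): no `const`
operand, no empty product, all comb parse trees of shape `T` ⇒ computed by a `GateTyped` circuit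
of shape `T` with `3(2|T|−1)((binz P).size+1)` gates (`Q = nfConv false T (binz P)`). MODEL
(module docstring: print-UPT of any fan-in ⇒ comb-UPT);
NOT a new lower bound; 0 S-currency; closes NO item; A_nc stmt-23446 / PerNotNcVP / VP ≠ VNP untouched.
[cite: LagardeLimayeSrinivasan2018, §3 Proposition 7, Lemma 8] -/
theorem exists_uptNF_of_combUPT (P : ArithCircuit R σ)
    (hc : ∀ g ∈ P.gates, ∀ u ∈ g.args, ∀ c, u ≠ Operand.const c)
    (hp : ∀ args, Gate.prod args ∈ P.gates → args ≠ [])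
    (ho : ∀ c, P.output ≠ Operand.const c) (T : Shape)
    (hT : ∀ e ∈ combCircuitPts P, e.1 = T) :
    ∃ (Q : ArithCircuit R σ) (ty : ℕ → List Bool),
      (∀ k (hk : k < Q.gates.length), GateTyped T ty (ty k) Q.gates[k]) ∧
      OpTyped T ty [] Q.output ∧ Q.ncEval = P.ncEval ∧
      Q.size = 3 * (2 * T.size - 1) * ((binz P).size + 1) := by
  obtain ⟨Q, ty, hg, hoQ, hQ, hs⟩ := exists_uptNF_of_upt (binz P) (binz_noConst P hc)
    (binz_prod_length P hp) (binz_output P ho) T (fun e he => hT e (by rwa [circuitPts_binz] at he))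
  exact ⟨Q, ty, hg, hoQ, hQ.trans (ncEval_binz P hc hp ho), hs⟩

/-- ★ comb-rot ⊆ rot-NF IN KERNEL, ANY PRODUCT FAN-IN (a KERNEL class at fan-in ≥ 3, module
docstring; = print-rotUPT at fan-in ≤ 2). MODEL (module docstring); NOT a new lower bound;
0 S-currency; closes NO item; A_nc stmt-23446 / PerNotNcVP / VP ≠ VNP untouched.
[cite: LagardeLimayeSrinivasan2018, §3 Lemma 8, §4 Theorem 17] -/
theorem exists_rotNF_of_combRot (P : ArithCircuit R σ)
    (hc : ∀ g ∈ P.gates, ∀ u ∈ g.args, ∀ c, u ≠ Operand.const c)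
    (hp : ∀ args, Gate.prod args ∈ P.gates → args ≠ [])
    (ho : ∀ c, P.output ≠ Operand.const c) (T : Shape)
    (hT : ∀ e ∈ combCircuitPts P, rotSim true e.1 T = true) :
    ∃ (Q : ArithCircuit R σ) (ty : ℕ → List Bool),
      (∀ k (hk : k < Q.gates.length), GateRot T ty (ty k) Q.gates[k]) ∧
      OpTyped T ty [] Q.output ∧ Q.ncEval = P.ncEval ∧
      Q.size = 3 * (2 * T.size - 1) * ((binz P).size + 1) := by
  obtain ⟨Q, ty, hg, hoQ, hQ, hs⟩ := exists_rotNF_of_rotUPT (binz P) (binz_noConst P hc)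
    (binz_prod_length P hp) (binz_output P ho) T (fun e he => hT e (by rwa [circuitPts_binz] at he))
  exact ⟨Q, ty, hg, hoQ, hQ.trans (ncEval_binz P hc hp ho), hs⟩

end Headlines

/-! ### §3 Transfers of the landed bounds, by name -/

section Transfer
variable (K : Type w) [Field K]

/-- ★ `PERM_{4r}` against comb-UPT circuits of ANY product fan-in (a fortiori PRINT-UPT, LLS18
§3 Theorem 10 with Lemma 8): `2^{r+1} ≤ 24r((binz P).size+1)`, `(binz P).size ≤ P.size + P.edgeSize`
(`size_binz_le`). MODEL (module docstring); NOT a new lower bound (the WEAKER constant of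
`ncPerPoly_uptPrint`, invoked BY NAME); 0 S-currency; closes NO item; A_nc stmt-23446 / PerNotNcVP
/ VP ≠ VNP untouched. [cite: LagardeLimayeSrinivasan2018, §3 Lemma 8, Theorem 10]
[cite: HrubesWigdersonYehudayoff2010, Lemma C.5] -/
theorem ncPerPoly_combUPT {r : ℕ} (hr : 1 ≤ r) (P : ArithCircuit K (Fin (4 * r) × Fin (4 * r)))
    (hc : ∀ g ∈ P.gates, ∀ u ∈ g.args, ∀ c, u ≠ Operand.const c)
    (hp : ∀ args, Gate.prod args ∈ P.gates → args ≠ [])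
    (ho : ∀ c, P.output ≠ Operand.const c) (T : Shape)
    (hT : ∀ e ∈ combCircuitPts P, e.1 = T) (h : P.ncEval = ncPerPoly K (4 * r)) :
    2 ^ (r + 1) ≤ 24 * r * ((binz P).size + 1) :=
  ncPerPoly_uptPrint K hr (binz P) (binz_noConst P hc) (binz_prod_length P hp) (binz_output P ho)
    T (fun e he => hT e (by rwa [circuitPts_binz] at he)) ((ncEval_binz P hc hp ho).trans h)

/-- ★ `PERM_{4r}` against comb-rot circuits of ANY product fan-in (kernel class): `2^{⌊(r+1)/3⌋}
≤ 96·r·r·((binz P).size+1)`. MODEL (module docstring); NOT a new lower bound (`ncPerPoly_rotUPT` BY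
NAME); 0 S-currency; closes NO item; A_nc stmt-23446 / PerNotNcVP / VP ≠ VNP untouched.
[cite: LagardeLimayeSrinivasan2018, §3 Lemma 8, §4 Theorem 17] -/
theorem ncPerPoly_combRot {r : ℕ} (hr : 1 ≤ r) (P : ArithCircuit K (Fin (4 * r) × Fin (4 * r)))
    (hc : ∀ g ∈ P.gates, ∀ u ∈ g.args, ∀ c, u ≠ Operand.const c)
    (hp : ∀ args, Gate.prod args ∈ P.gates → args ≠ [])
    (ho : ∀ c, P.output ≠ Operand.const c) (T : Shape)
    (hT : ∀ e ∈ combCircuitPts P, rotSim true e.1 T = true) (h : P.ncEval = ncPerPoly K (4 * r)) :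
    2 ^ ((r + 1) / 3) ≤ 96 * r * r * ((binz P).size + 1) :=
  ncPerPoly_rotUPT K hr (binz P) (binz_noConst P hc) (binz_prod_length P hp) (binz_output P ho)
    T (fun e he => hT e (by rwa [circuitPts_binz] at he)) ((ncEval_binz P hc hp ho).trans h)

/-- ★ `LID_r` against comb-rot circuits of ANY product fan-in (kernel class): `2^{⌊(r+1)/3⌋}
≤ 96·r·r·((binz P).size+1)`. MODEL (module docstring); NOT a new lower bound (`lidPoly_rotUPT` BY
NAME); 0 S-currency; closes NO item; A_nc stmt-23446 / PerNotNcVP / VP ≠ VNP untouched.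
[cite: LagardeLimayeSrinivasan2018, §3 Lemma 8, §4 Theorem 17] -/
theorem lidPoly_combRot {r : ℕ} (hr : 1 ≤ r) (P : ArithCircuit K (Fin 2))
    (hc : ∀ g ∈ P.gates, ∀ u ∈ g.args, ∀ c, u ≠ Operand.const c)
    (hp : ∀ args, Gate.prod args ∈ P.gates → args ≠ [])
    (ho : ∀ c, P.output ≠ Operand.const c) (T : Shape)
    (hT : ∀ e ∈ combCircuitPts P, rotSim true e.1 T = true) (h : P.ncEval = lidPoly K r) :
    2 ^ ((r + 1) / 3) ≤ 96 * r * r * ((binz P).size + 1) :=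
  lidPoly_rotUPT K hr (binz P) (binz_noConst P hc) (binz_prod_length P hp) (binz_output P ho)
    T (fun e he => hT e (by rwa [circuitPts_binz] at he)) ((ncEval_binz P hc hp ho).trans h)

end Transfer

/-! ### §4 Eventually-forms along `n = 4r` -/

/-- ★ **comb-rot rung (kernel class, any product fan-in), eventually-form along `n = 4r`**, in
gates + wires. MODEL (module docstring); NOT a new lower bound (`perNotNcRotUPT_eventually` BY
NAME); 0 S-currency; closes NO item; A_nc stmt-23446 / PerNotNcVP / VP ≠ VNP untouched.
[cite: LagardeLimayeSrinivasan2018, §3 Lemma 8, §4 Theorem 17] -/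
theorem perNotNcCombRot_eventually (c : ℕ) : ∃ r₀ : ℕ, ∀ r, r₀ ≤ r →
    ∀ (P : ArithCircuit ℂ (Fin (4 * r) × Fin (4 * r))) (T : Shape),
      (∀ g ∈ P.gates, ∀ u ∈ g.args, ∀ c, u ≠ Operand.const c) →
      (∀ args, Gate.prod args ∈ P.gates → args ≠ []) →
      (∀ c, P.output ≠ Operand.const c) →
      (∀ e ∈ combCircuitPts P, rotSim true e.1 T = true) →
      P.ncEval = ncPerPoly ℂ (4 * r) → (4 * r) ^ c + c < P.size + P.edgeSize := by
  obtain ⟨r₀, h₀⟩ := perNotNcRotUPT_eventually c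
  refine ⟨r₀, fun r hr P T hc hp ho hT h => lt_of_lt_of_le ?_ (size_binz_le P)⟩
  exact h₀ r hr (binz P) T (binz_noConst P hc) (binz_prod_length P hp) (binz_output P ho)
    (fun e he => hT e (by rwa [circuitPts_binz] at he)) ((ncEval_binz P hc hp ho).trans h)

/-- ★★ **PRINT-UPT RUNG FOR PRODUCT GATES OF ANY FAN-IN, eventually-form along `n = 4r`** (LLS18
§3 Theorem 10 with Lemma 8; comb-UPT ⊇ print-UPT): for every `c`, eventually in `r`, every circuit
for `PERM_{4r}` without `const` operands or empty products all of whose (comb) parse trees have one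
shape has more than `(4r)^c + c` gates + wires. NON-VACUOUS (module docstring: the `(4r)!`-term
circuits with `4r`-ary products). MODEL (module docstring); NOT a new lower bound
(`perNotNcUPT_eventually` BY NAME, WEAKER than the typed rung); 0 S-currency; closes NO item; A_nc
stmt-23446 / PerNotNcVP / VP ≠ VNP untouched. [cite: LagardeLimayeSrinivasan2018, §3 Lemma 8, Theorem 10] -/
theorem perNotNcCombUPT_eventually (c : ℕ) : ∃ r₀ : ℕ, ∀ r, r₀ ≤ r →
    ∀ (P : ArithCircuit ℂ (Fin (4 * r) × Fin (4 * r))) (T : Shape),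
      (∀ g ∈ P.gates, ∀ u ∈ g.args, ∀ c, u ≠ Operand.const c) →
      (∀ args, Gate.prod args ∈ P.gates → args ≠ []) →
      (∀ c, P.output ≠ Operand.const c) →
      (∀ e ∈ combCircuitPts P, e.1 = T) →
      P.ncEval = ncPerPoly ℂ (4 * r) → (4 * r) ^ c + c < P.size + P.edgeSize := by
  obtain ⟨r₀, h₀⟩ := perNotNcUPT_eventually c
  refine ⟨r₀, fun r hr P T hc hp ho hT h => lt_of_lt_of_le ?_ (size_binz_le P)⟩
  exact h₀ r hr (binz P) T (binz_noConst P hc) (binz_prod_length P hp) (binz_output P ho)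
    (fun e he => hT e (by rwa [circuitPts_binz] at he)) ((ncEval_binz P hc hp ho).trans h)

end Summit.ValiantsHypothesis.ValiantsHypothesis.Theorems.NcBinarisationPermanent
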